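import Summits.AtomisticToContinuum.FouriersLaw.Theses.EmbeddedDrudeMourre

/-!
# FGRGap · line `fold-jet-rigidity` · stub `stub_noOddC1Invariant` — part A: the velocity involution

Support file (A) for the registered stub `stub_noOddC1Invariant` of crux `EmbeddedDrudeMourre.FGRGap`
(stmt-AtomisticToContinuum-12595): every odd `C¹` `2π`-periodic collisional invariant of the pinned
band `ω(k) = √(ω₂ + 2(1 - cos k))`, `ω₂ > 0`, vanishes. Here: the elementary geometry of the group
velocity `v = sin/ω = ω'` that the grazing/descent argument consumes. Throughout `A := ω₂ + 2 > 2`.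

* `hasDerivAt_groupVelocity`: `v' = (A cos k - cos² k - 1)/ω³`.
* THE VELOCITY INVOLUTION IS A MÖBIUS MAP IN `cos k`. For `x, y ∈ [0, π]` one has `v x = v y` iff
  `y = x` or `cos y = μ (cos x)`, `μ(c) = (2 - A c)/(A - 2 c)`: indeed `v² = (1 - c²)/(A - 2c)`,
  `c = cos`, and `(1 - c²)(A - 2d) - (1 - d²)(A - 2c) = (d - c)(A (c + d) - 2 - 2 c d)`. The map `μ` is
  an order-reversing involution of `[-1, 1]` (its matrix squares to `(A² - 4)·1`), so "the other
  point with the same group velocity" is EXPLICIT, `σ = arccos ∘ μ ∘ cos`: a strictly decreasing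
  involution of `[0, π]` with `v ∘ σ = v` (`exists_velocityInvolution`). Its fixed points are exactly
  the critical points of `v` (`μ c = c ⇔ c² - A c + 1 = 0 ⇔ v' = 0`), and `σ x ≠ π - x` on `(0, π)`
  (`μ c = -c ⇔ c² = 1`). No unimodality analysis of `v` (no `k_m`, no `c_±`) is needed downstream.
* `exists_delta_of_hasDerivAt`, `mul_pos_of_abs_sub_lt`: the `ε–δ` form of `HasDerivAt` and the
  sign of a slope close to a non-zero derivative (used by the grazing law in part B).
* `le_apply_zero_of_invariant`: the DESCENT lemma — a continuous `g` with `g (π - x) = g x` and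
  `g (σ x) = g x` on `(0, π)` satisfies `g ≤ g 0` on `[0, π]` (look at the least maximiser `x₁`:
  one of the maximisers `π - σ x₁`, `σ (π - x₁)` is smaller, because `σ` reverses order and
  `σ x₁ ≠ π - x₁`). Applied to `±ψ'` it makes `ψ'` constant on `[0, π]`.

All statements are folklore calculus; the Möbius form of the involution is our bookkeeping device
(cf. the explicit `arccos` formula for the ALS branch `h` in Lukkarinen 2016 §2.2.4).
-/

noncomputable section

open MeasureTheory Set Real Filter Topology
open scoped ENNReal
open Literature.MathematicalPhysics.KineticTheory.PhononBoltzmann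

namespace Summit.AtomisticToContinuum.FouriersLaw.Theorems.FGRGap.FoldJetRigidity.OddC1

variable {ω₂ : ℝ}

/-! ## 1. The group velocity: derivative, square, sign -/

/-- `v'(k) = ((ω₂ + 2) cos k - cos² k - 1) / ω(k)³` for the group velocity `v = sin/ω` of the
pinned band (`ω² = ω₂ + 2 - 2 cos k`). [folklore] -/
theorem hasDerivAt_groupVelocity (hω : 0 < ω₂) (k : ℝ) :
    HasDerivAt (groupVelocity ω₂)
      (((ω₂ + 2) * Real.cos k - Real.cos k ^ 2 - 1) / dispersion ω₂ k ^ 3) k := by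
  have hd := hasDerivAt_dispersion hω k
  have hpos := dispersion_pos hω k
  have hD : dispersion ω₂ k ≠ 0 := hpos.ne'
  have h := (Real.hasDerivAt_sin k).div hd hD
  have hfun : groupVelocity ω₂ = fun x => Real.sin x / dispersion ω₂ x := rfl
  rw [hfun]
  refine h.congr_deriv ?_
  have hsq : dispersion ω₂ k ^ 2 = ω₂ + 2 * (1 - Real.cos k) := dispersion_sq hω.le k
  have hsc := Real.sin_sq_add_cos_sq k
  have key : Real.cos k * dispersion ω₂ k - Real.sin k * groupVelocity ω₂ k =
      ((ω₂ + 2) * Real.cos k - Real.cos k ^ 2 - 1) / dispersion ω₂ k := by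
    unfold groupVelocity
    rw [eq_div_iff hD]
    have h1 : (Real.cos k * dispersion ω₂ k - Real.sin k * (Real.sin k / dispersion ω₂ k)) *
        dispersion ω₂ k = Real.cos k * dispersion ω₂ k ^ 2 - Real.sin k ^ 2 := by
      field_simp
    rw [h1, hsq]
    linear_combination (-1 : ℝ) * hsc
  rw [key, div_div, ← pow_succ']

/-- `v(k)² = (1 - cos² k)/((ω₂ + 2) - 2 cos k)`. [folklore] -/
theorem groupVelocity_sq (hω : 0 < ω₂) (x : ℝ) :
    groupVelocity ω₂ x ^ 2 = (1 - Real.cos x ^ 2) / ((ω₂ + 2) - 2 * Real.cos x) := by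
  unfold groupVelocity
  rw [div_pow, dispersion_sq hω.le, Real.sin_sq]
  congr 1
  ring

/-- `v ≥ 0` on `[0, π]`. [folklore] -/
theorem groupVelocity_nonneg (hω : 0 < ω₂) {x : ℝ} (hx : x ∈ Icc 0 π) :
    0 ≤ groupVelocity ω₂ x :=
  div_nonneg (Real.sin_nonneg_of_nonneg_of_le_pi hx.1 hx.2) (dispersion_pos hω x).le

/-! ## 2. The Möbius involution `μ(c) = (2 - A c)/(A - 2c)` of `[-1, 1]`, `A = ω₂ + 2` -/

section Mobius

variable {μ : ℝ → ℝ}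

/-- `0 < A - 2c` for `c ≤ 1`. [folklore] -/
theorem mobius_den_pos (hω : 0 < ω₂) {c : ℝ} (hc : c ≤ 1) : 0 < (ω₂ + 2) - 2 * c := by
  linarith

/-- `μ` maps `[-1, 1]` into `[-1, 1]` (`μ 1 = -1`, `μ (-1) = 1`). [folklore] -/
theorem mobius_mem_Icc (hω : 0 < ω₂) (hμ : ∀ c, μ c = (2 - (ω₂ + 2) * c) / ((ω₂ + 2) - 2 * c))
    {c : ℝ} (hc : c ∈ Icc (-1 : ℝ) 1) : μ c ∈ Icc (-1 : ℝ) 1 := by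
  have hden := mobius_den_pos hω hc.2
  rw [hμ]
  constructor
  · rw [le_div_iff₀ hden]
    nlinarith [hc.1, hc.2]
  · rw [div_le_iff₀ hden]
    nlinarith [hc.1, hc.2]

/-- `A - 2 μ(c) = (A² - 4)/(A - 2c) > 0` for `c ≤ 1`. [folklore] -/
theorem mobius_den_pos' (hω : 0 < ω₂) (hμ : ∀ c, μ c = (2 - (ω₂ + 2) * c) / ((ω₂ + 2) - 2 * c))
    {c : ℝ} (hc : c ≤ 1) : 0 < (ω₂ + 2) - 2 * μ c := by
  have hden := mobius_den_pos hω hc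
  have : (ω₂ + 2) - 2 * μ c = ((ω₂ + 2) ^ 2 - 4) / ((ω₂ + 2) - 2 * c) := by
    rw [hμ]
    field_simp
    ring
  rw [this]
  exact div_pos (by nlinarith) hden

/-- `μ` is an involution: `μ (μ c) = c` (`c ≤ 1`). [folklore] -/
theorem mobius_mobius (hω : 0 < ω₂) (hμ : ∀ c, μ c = (2 - (ω₂ + 2) * c) / ((ω₂ + 2) - 2 * c))
    {c : ℝ} (hc : c ≤ 1) : μ (μ c) = c := by
  have h1 := (mobius_den_pos hω hc).ne'
  have h2 := (mobius_den_pos' hω hμ hc).ne'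
  rw [hμ (μ c), div_eq_iff h2, hμ c]
  rw [hμ c] at h2
  field_simp
  ring

/-- `μ` is strictly decreasing on `(-∞, 1]`. [folklore] -/
theorem mobius_strictAntiOn (hω : 0 < ω₂)
    (hμ : ∀ c, μ c = (2 - (ω₂ + 2) * c) / ((ω₂ + 2) - 2 * c)) : StrictAntiOn μ (Iic 1) := by
  intro c₁ hc₁ c₂ hc₂ hlt
  have h₁ := mobius_den_pos hω (show c₁ ≤ 1 from hc₁)
  have h₂ := mobius_den_pos hω (show c₂ ≤ 1 from hc₂)
  rw [hμ, hμ, div_lt_div_iff₀ h₂ h₁]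
  have key : (2 - (ω₂ + 2) * c₁) * ((ω₂ + 2) - 2 * c₂) - (2 - (ω₂ + 2) * c₂) * ((ω₂ + 2) - 2 * c₁)
      = (ω₂ ^ 2 + 4 * ω₂) * (c₂ - c₁) := by ring
  have hpos : 0 < (ω₂ ^ 2 + 4 * ω₂) * (c₂ - c₁) := mul_pos (by positivity) (sub_pos.2 hlt)
  linarith

/-- `μ` preserves `v²` written in `c = cos k`: `(1 - μ(c)²)/(A - 2μ(c)) = (1 - c²)/(A - 2c)`.
[folklore] -/
theorem mobius_sq_div (hω : 0 < ω₂) (hμ : ∀ c, μ c = (2 - (ω₂ + 2) * c) / ((ω₂ + 2) - 2 * c))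
    {c : ℝ} (hc : c ≤ 1) :
    (1 - μ c ^ 2) / ((ω₂ + 2) - 2 * μ c) = (1 - c ^ 2) / ((ω₂ + 2) - 2 * c) := by
  have h1 := (mobius_den_pos hω hc).ne'
  have h2 := (mobius_den_pos' hω hμ hc).ne'
  rw [div_eq_div_iff h2 h1]
  rw [hμ c] at h2 ⊢
  field_simp
  ring

/-- Critical points of `v` are fixed points of `μ`: `A c - c² - 1 = 0 ⇒ μ c = c`. [folklore] -/
theorem mobius_eq_self (hω : 0 < ω₂) (hμ : ∀ c, μ c = (2 - (ω₂ + 2) * c) / ((ω₂ + 2) - 2 * c))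
    {c : ℝ} (hc : c ≤ 1) (h : (ω₂ + 2) * c - c ^ 2 - 1 = 0) : μ c = c := by
  rw [hμ, div_eq_iff (mobius_den_pos hω hc).ne']
  linear_combination (-2 : ℝ) * h

/-- `μ c ≠ -c` for `|c| < 1` (`μ c = -c ⇔ c² = 1`). [folklore] -/
theorem mobius_ne_neg (hω : 0 < ω₂) (hμ : ∀ c, μ c = (2 - (ω₂ + 2) * c) / ((ω₂ + 2) - 2 * c))
    {c : ℝ} (hc : c ∈ Ioo (-1 : ℝ) 1) : μ c ≠ -c := by
  rw [hμ, Ne, div_eq_iff (mobius_den_pos hω hc.2.le).ne']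
  intro h
  nlinarith [hc.1, hc.2, mul_pos (sub_pos.2 hc.2) (neg_lt_iff_pos_add.1 hc.1)]

end Mobius

/-! ## 3. The velocity involution `σ = arccos ∘ μ ∘ cos` of `[0, π]` -/

section Star

variable {σ : ℝ → ℝ}

/-- `cos (σ x) = μ (cos x)`. [folklore] -/
theorem cos_star (hω : 0 < ω₂)
    (hσ : ∀ x, σ x = Real.arccos ((2 - (ω₂ + 2) * Real.cos x) / ((ω₂ + 2) - 2 * Real.cos x)))
    (x : ℝ) : Real.cos (σ x) = (2 - (ω₂ + 2) * Real.cos x) / ((ω₂ + 2) - 2 * Real.cos x) := by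
  have h := mobius_mem_Icc (μ := fun c => (2 - (ω₂ + 2) * c) / ((ω₂ + 2) - 2 * c)) hω
    (fun _ => rfl) ⟨Real.neg_one_le_cos x, Real.cos_le_one x⟩
  rw [hσ]
  exact Real.cos_arccos h.1 h.2

/-- `σ x ∈ [0, π]`. [folklore] -/
theorem star_mem_Icc
    (hσ : ∀ x, σ x = Real.arccos ((2 - (ω₂ + 2) * Real.cos x) / ((ω₂ + 2) - 2 * Real.cos x)))
    (x : ℝ) : σ x ∈ Icc 0 π := by
  rw [hσ]
  exact ⟨Real.arccos_nonneg _, Real.arccos_le_pi _⟩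

/-- `σ` is an involution of `[0, π]`. [folklore] -/
theorem star_star (hω : 0 < ω₂)
    (hσ : ∀ x, σ x = Real.arccos ((2 - (ω₂ + 2) * Real.cos x) / ((ω₂ + 2) - 2 * Real.cos x)))
    {x : ℝ} (hx : x ∈ Icc 0 π) : σ (σ x) = x := by
  rw [hσ (σ x), cos_star hω hσ x,
    mobius_mobius (μ := fun c => (2 - (ω₂ + 2) * c) / ((ω₂ + 2) - 2 * c)) hω (fun _ => rfl)
      (Real.cos_le_one x),
    Real.arccos_cos hx.1 hx.2]

/-- `σ` is strictly decreasing on `[0, π]`. [folklore] -/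
theorem star_strictAntiOn (hω : 0 < ω₂)
    (hσ : ∀ x, σ x = Real.arccos ((2 - (ω₂ + 2) * Real.cos x) / ((ω₂ + 2) - 2 * Real.cos x))) :
    StrictAntiOn σ (Icc 0 π) := by
  intro x hx y hy hxy
  have hc : Real.cos y < Real.cos x := Real.strictAntiOn_cos hx hy hxy
  have hμ := mobius_strictAntiOn (μ := fun c => (2 - (ω₂ + 2) * c) / ((ω₂ + 2) - 2 * c)) hω
    (fun _ => rfl) (Real.cos_le_one y) (Real.cos_le_one x) hc
  have hmx := mobius_mem_Icc (μ := fun c => (2 - (ω₂ + 2) * c) / ((ω₂ + 2) - 2 * c)) hω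
    (fun _ => rfl) ⟨Real.neg_one_le_cos x, Real.cos_le_one x⟩
  have hmy := mobius_mem_Icc (μ := fun c => (2 - (ω₂ + 2) * c) / ((ω₂ + 2) - 2 * c)) hω
    (fun _ => rfl) ⟨Real.neg_one_le_cos y, Real.cos_le_one y⟩
  rw [hσ x, hσ y]
  exact Real.strictAntiOn_arccos hmx hmy hμ

/-- `σ` maps `(0, π)` into `(0, π)`. [folklore] -/
theorem star_mem_Ioo (hω : 0 < ω₂)
    (hσ : ∀ x, σ x = Real.arccos ((2 - (ω₂ + 2) * Real.cos x) / ((ω₂ + 2) - 2 * Real.cos x)))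
    {x : ℝ} (hx : x ∈ Ioo 0 π) : σ x ∈ Ioo 0 π := by
  have h0 : (0 : ℝ) ∈ Icc 0 π := ⟨le_rfl, Real.pi_pos.le⟩
  have hπ : π ∈ Icc 0 π := ⟨Real.pi_pos.le, le_rfl⟩
  have hxI : x ∈ Icc 0 π := Ioo_subset_Icc_self hx
  constructor
  · calc (0 : ℝ) ≤ σ π := (star_mem_Icc hσ π).1
      _ < σ x := star_strictAntiOn hω hσ hxI hπ hx.2
  · calc σ x < σ 0 := star_strictAntiOn hω hσ h0 hxI hx.1
      _ ≤ π := (star_mem_Icc hσ 0).2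

/-- `v (σ x) = v x` on `[0, π]`: `σ x` is the other momentum with the same group velocity.
[folklore] -/
theorem groupVelocity_star (hω : 0 < ω₂)
    (hσ : ∀ x, σ x = Real.arccos ((2 - (ω₂ + 2) * Real.cos x) / ((ω₂ + 2) - 2 * Real.cos x)))
    {x : ℝ} (hx : x ∈ Icc 0 π) : groupVelocity ω₂ (σ x) = groupVelocity ω₂ x := by
  have h1 : 0 ≤ groupVelocity ω₂ (σ x) := groupVelocity_nonneg hω (star_mem_Icc hσ x)
  have h2 : 0 ≤ groupVelocity ω₂ x := groupVelocity_nonneg hω hx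
  rw [← sq_eq_sq₀ h1 h2, groupVelocity_sq hω, groupVelocity_sq hω, cos_star hω hσ x]
  exact mobius_sq_div (μ := fun c => (2 - (ω₂ + 2) * c) / ((ω₂ + 2) - 2 * c)) hω (fun _ => rfl)
    (Real.cos_le_one x)

/-- No interior momentum is paired with its mirror image: `σ x ≠ π - x` for `x ∈ (0, π)`
(`v (π - x) = v x` only at `x = π/2`, which is not critical). [folklore] -/
theorem star_ne_pi_sub (hω : 0 < ω₂)
    (hσ : ∀ x, σ x = Real.arccos ((2 - (ω₂ + 2) * Real.cos x) / ((ω₂ + 2) - 2 * Real.cos x)))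
    {x : ℝ} (hx : x ∈ Ioo 0 π) : σ x ≠ π - x := by
  intro h
  have hc : Real.cos (σ x) = -Real.cos x := by rw [h, Real.cos_pi_sub]
  rw [cos_star hω hσ x] at hc
  have h1 : Real.cos x < 1 := by
    have := Real.strictAntiOn_cos ⟨le_rfl, Real.pi_pos.le⟩ (Ioo_subset_Icc_self hx) hx.1
    rwa [Real.cos_zero] at this
  have h2 : -1 < Real.cos x := by
    have := Real.strictAntiOn_cos (Ioo_subset_Icc_self hx) ⟨Real.pi_pos.le, le_rfl⟩ hx.2
    rwa [Real.cos_pi] at this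
  exact mobius_ne_neg (μ := fun c => (2 - (ω₂ + 2) * c) / ((ω₂ + 2) - 2 * c)) hω (fun _ => rfl)
    ⟨h2, h1⟩ hc

/-- Fixed points of `σ` are the critical points of `v`: if the numerator of `v'` vanishes at `σ x`
then `σ x = x` (`x ∈ [0, π]`). [folklore] -/
theorem star_eq_self_of_eq_zero (hω : 0 < ω₂)
    (hσ : ∀ x, σ x = Real.arccos ((2 - (ω₂ + 2) * Real.cos x) / ((ω₂ + 2) - 2 * Real.cos x)))
    {x : ℝ} (hx : x ∈ Icc 0 π)
    (h : (ω₂ + 2) * Real.cos (σ x) - Real.cos (σ x) ^ 2 - 1 = 0) : σ x = x := by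
  have hz := star_mem_Icc hσ x
  have hμ := mobius_eq_self (μ := fun c => (2 - (ω₂ + 2) * c) / ((ω₂ + 2) - 2 * c)) hω
    (fun _ => rfl) (Real.cos_le_one (σ x)) h
  have hfix : σ (σ x) = σ x := by
    conv_lhs => rw [hσ (σ x)]
    rw [hμ, Real.arccos_cos hz.1 hz.2]
  rw [star_star hω hσ hx] at hfix
  exact hfix.symm

end Star

/-- **The velocity involution of the pinned band** (`ω₂ > 0`). There is a strictly decreasing
involution `σ` of `[0, π]` with `v ∘ σ = v`, with `σ x ≠ π - x` on `(0, π)`, and whose fixed points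
are critical points of `v`: if `v' (σ x) = 0` (numerator `(ω₂+2) cos - cos² - 1`) then `σ x = x`.
Explicitly `σ = arccos ∘ μ ∘ cos`, `μ c = (2 - (ω₂+2) c)/((ω₂+2) - 2c)`. [folklore] -/
theorem exists_velocityInvolution (hω : 0 < ω₂) : ∃ σ : ℝ → ℝ,
    (∀ x, σ x ∈ Icc 0 π) ∧ StrictAntiOn σ (Icc 0 π) ∧ (∀ x ∈ Icc 0 π, σ (σ x) = x) ∧
      (∀ x ∈ Ioo 0 π, σ x ∈ Ioo 0 π) ∧
      (∀ x ∈ Icc 0 π, groupVelocity ω₂ (σ x) = groupVelocity ω₂ x) ∧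
      (∀ x ∈ Ioo 0 π, σ x ≠ π - x) ∧
      (∀ x ∈ Icc 0 π, (ω₂ + 2) * Real.cos (σ x) - Real.cos (σ x) ^ 2 - 1 = 0 → σ x = x) := by
  refine ⟨fun x => Real.arccos ((2 - (ω₂ + 2) * Real.cos x) / ((ω₂ + 2) - 2 * Real.cos x)),
    star_mem_Icc (fun _ => rfl), star_strictAntiOn hω (fun _ => rfl),
    fun x hx => star_star hω (fun _ => rfl) hx, fun x hx => star_mem_Ioo hω (fun _ => rfl) hx,
    fun x hx => groupVelocity_star hω (fun _ => rfl) hx,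
    fun x hx => star_ne_pi_sub hω (fun _ => rfl) hx,
    fun x hx h => star_eq_self_of_eq_zero hω (fun _ => rfl) hx h⟩

/-! ## 4. Two `ε–δ` devices -/

/-- The `ε–δ` form of `HasDerivAt` for real functions. [folklore] -/
theorem exists_delta_of_hasDerivAt {f : ℝ → ℝ} {f' x : ℝ} (h : HasDerivAt f f' x) {ε : ℝ}
    (hε : 0 < ε) : ∃ δ > 0, ∀ t : ℝ, t ≠ 0 → |t| < δ → |(f (x + t) - f x) / t - f'| < ε := by
  have ht := h.tendsto_slope_zero
  rw [Metric.tendsto_nhdsWithin_nhds] at ht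
  obtain ⟨δ, hδ, hδ'⟩ := ht ε hε
  refine ⟨δ, hδ, fun t ht0 htδ => ?_⟩
  have h1 := hδ' (x := t) ht0 (by rwa [Real.dist_eq, sub_zero])
  rw [Real.dist_eq] at h1
  simpa [smul_eq_mul, div_eq_inv_mul] using h1

/-- A slope within `|d|/2` of a non-zero derivative `d` has the sign of `d`. [folklore] -/
theorem mul_pos_of_abs_sub_lt {s d : ℝ} (h : |s - d| < |d| / 2) : 0 < d * s := by
  rcases lt_trichotomy d 0 with hd | hd | hd
  · rw [abs_of_neg hd, abs_lt] at h
    exact mul_pos_of_neg_of_neg hd (by linarith [h.2])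
  · rw [hd, abs_zero] at h
    linarith [abs_nonneg (s - 0)]
  · rw [abs_of_pos hd, abs_lt] at h
    exact mul_pos hd (by linarith [h.1])

/-! ## 5. Descent: a continuous function invariant under `π - ·` and `σ` is maximal at `0` -/

/-- **Descent lemma.** Let `σ` be a strictly decreasing involution of `[0, π]` mapping `(0, π)` to
itself with `σ x ≠ π - x` on `(0, π)`, and let `g` be continuous with `g (π - x) = g x` for all `x`
and `g (σ x) = g x` on `(0, π)`. Then `g x ≤ g 0` on `[0, π]`. (If the maximum `m` over `[0, π]`
exceeded `g 0 = g π`, the least maximiser `x₁` would lie in `(0, π)`; both `π - σ x₁` and `σ (π - x₁)`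
are maximisers, and since `σ x₁ ≠ π - x₁` and `σ` reverses order one of them is `< x₁`.) [folklore] -/
theorem le_apply_zero_of_invariant {σ g : ℝ → ℝ} (hσI : ∀ x, σ x ∈ Icc 0 π)
    (hσa : StrictAntiOn σ (Icc 0 π)) (hσσ : ∀ x ∈ Icc 0 π, σ (σ x) = x)
    (hσo : ∀ x ∈ Ioo 0 π, σ x ∈ Ioo 0 π) (hσπ : ∀ x ∈ Ioo 0 π, σ x ≠ π - x)
    (hg : Continuous g) (hgπ : ∀ x, g (π - x) = g x) (hgσ : ∀ x ∈ Ioo 0 π, g (σ x) = g x) :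
    ∀ x ∈ Icc 0 π, g x ≤ g 0 := by
  by_contra hcon
  push Not at hcon
  obtain ⟨x₀, hx₀, hmax⟩ :=
    isCompact_Icc.exists_isMaxOn (nonempty_Icc.2 Real.pi_pos.le) hg.continuousOn
  have hm0 : g 0 < g x₀ := by
    obtain ⟨x, hx, hlt⟩ := hcon
    exact hlt.trans_le (hmax hx)
  set M : Set ℝ := Icc 0 π ∩ g ⁻¹' {g x₀} with hM
  have hMc : IsClosed M := isClosed_Icc.inter (isClosed_singleton.preimage hg)
  have hMne : M.Nonempty := ⟨x₀, hx₀, rfl⟩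
  have hMbdd : BddBelow M := ⟨0, fun x hx => hx.1.1⟩
  have hx₁M : sInf M ∈ M := hMc.csInf_mem hMne hMbdd
  have hx₁min : ∀ x ∈ M, sInf M ≤ x := fun x hx => csInf_le hMbdd hx
  set x₁ := sInf M with hx₁
  have hx₁I : x₁ ∈ Icc 0 π := hx₁M.1
  have hgx₁ : g x₁ = g x₀ := hx₁M.2
  have hx₁0 : x₁ ≠ 0 := fun h => by
    rw [h] at hgx₁
    linarith
  have hx₁π : x₁ ≠ π := fun h => by
    rw [h, show π = π - 0 by ring, hgπ] at hgx₁
    linarith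
  have hx₁oo : x₁ ∈ Ioo 0 π :=
    ⟨lt_of_le_of_ne hx₁I.1 (Ne.symm hx₁0), lt_of_le_of_ne hx₁I.2 hx₁π⟩
  have hσx₁ := hσo x₁ hx₁oo
  have hπx₁ : π - x₁ ∈ Ioo 0 π := ⟨by linarith [hx₁oo.2], by linarith [hx₁oo.1]⟩
  have h1 : π - σ x₁ ∈ M := by
    refine ⟨⟨by linarith [hσx₁.2], by linarith [hσx₁.1]⟩, ?_⟩
    show g (π - σ x₁) = g x₀
    rw [hgπ, hgσ x₁ hx₁oo, hgx₁]
  have h2 : σ (π - x₁) ∈ M := by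
    refine ⟨hσI _, ?_⟩
    show g (σ (π - x₁)) = g x₀
    rw [hgσ _ hπx₁, hgπ, hgx₁]
  have h3 := hx₁min _ h1
  have h4 := hx₁min _ h2
  have h5 : σ x₁ < π - x₁ := lt_of_le_of_ne (by linarith) (hσπ x₁ hx₁oo)
  have h6 := hσa (hσI x₁) (Ioo_subset_Icc_self hπx₁) h5
  rw [hσσ x₁ hx₁I] at h6
  linarith

end Summit.AtomisticToContinuum.FouriersLaw.Theorems.FGRGap.FoldJetRigidity.OddC1

namespace Summit.AtomisticToContinuum.FouriersLaw.Theorems.FGRGap.FoldJetRigidity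

/-- **Registered helper stub `stub_noOddC1Invariant_partA`** (line `fold-jet-rigidity`, crux
`EmbeddedDrudeMourre.FGRGap`, worker OddC1, file A): the explicit velocity involution `σ` of the
pinned band — range in `[0, π]`, strictly decreasing, involutive, `(0, π) → (0, π)`, `v ∘ σ = v`,
`σ x ≠ π - x` in the interior, and fixed points = critical points of `v`
(`OddC1.exists_velocityInvolution`). [folklore] -/
theorem stub_noOddC1Invariant_partA :
    ∀ ω₂ : ℝ, 0 < ω₂ → ∃ σ : ℝ → ℝ,
      (∀ x, σ x ∈ Set.Icc 0 π) ∧ StrictAntiOn σ (Set.Icc 0 π) ∧ (∀ x ∈ Set.Icc 0 π, σ (σ x) = x) ∧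
      (∀ x ∈ Set.Ioo 0 π, σ x ∈ Set.Ioo 0 π) ∧
      (∀ x ∈ Set.Icc 0 π, groupVelocity ω₂ (σ x) = groupVelocity ω₂ x) ∧
      (∀ x ∈ Set.Ioo 0 π, σ x ≠ π - x) ∧
      (∀ x ∈ Set.Icc 0 π, (ω₂ + 2) * Real.cos (σ x) - Real.cos (σ x) ^ 2 - 1 = 0 → σ x = x) :=
  fun _ hω => OddC1.exists_velocityInvolution hω

end Summit.AtomisticToContinuum.FouriersLaw.Theorems.FGRGap.FoldJetRigidity

end
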